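/-
Copyright (c) 2026 the pub-hodgecm-mathlib formalisation cell (harness21).  Prover seat hodgecm-mathlib-K2E1b-p15 (g0) on loan to engine E3, Track B ∕ K2-LIT
(build stream 29), h413 = `stmt-HodgeConjecture-24833`, line `K2_E3_EllipticInputs`, unit U12 «Characters», sub-skeleton U12d (K2E3-p12): sub-socket (S-d)
«conjugates of the Cayley slice fill a neighbourhood» AT A CENTRAL POINT.  2026-09-03.
-/
import Literature.NumberTheory.Automorphic.AdelicUnitaryGroupDatum    -- ★ `UnitaryGroup.cmDatum`, `.Local v`, `LocalRing`, `conjLocal`, `adelicForm`, `adeleToLocal`, `unitaryGroupOfForm`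
import Literature.NumberTheory.Automorphic.UnitaryGroupLocalFactors     -- ★ `instFinitePlacesOver` (finitely many places over `v`)
import Mathlib.Topology.Instances.Matrix                              -- `continuousAt_matrix_inv`, `Continuous.matrix_det`
import Mathlib.LinearAlgebra.Matrix.NonsingularInverse
import HarnessLib

/-!
# h413 ∕ Track B «K2-LIT», line `K2_E3_EllipticInputs`, U12d (S-d) at a CENTRAL point: every element of `U(H)(L⁺_v)` near a central `s = ζ·1` IS `s · c(Y)`
# for a small `J_v`-skew `Y` — the inverse Cayley transform `Y = (s⁻¹g − 1)(s⁻¹g + 1)⁻¹`, its skewness, and its continuity at `s`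

Cell `pub/hodgecm-mathlib`, crux H413 = `stmt-HodgeConjecture-24833`, route of record `HCCMUnconditional`; chair K2-lead (g0); dealt BY NAME by K2E3-p12 (g0) for the E3
dealer K2E3-plan (g1) (DEALS BATCH #2; 2026-09-03T22:16:32Z + 22:22:30Z «NEXT RUNG BY NAME FOR YOU: `Theorems/K2E3CayleySliceCoversNhdsCentral.lean` = (S-d) of SUBSIGS
8fea84bcf8bff209 at a CENTRAL point … x := 1; `M := MAT(s⁻¹ * g)`, `Y := (M − 1) * (M + 1)⁻¹` …»).  THEOREMS ONLY (no `def`, no `instance`, no `notation`, no named-fact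
hypothesis, no `sorry`); imports = ★ `AdelicUnitaryGroupDatum` + Mathlib + HarnessLib (never a `Cruxes/…/Lines` module); lane `--supports stmt-HodgeConjecture-24833 --as helper`.

THE STATEMENT (the (S-d) clause bytes of `K2/K2E3-p12/g0/SUBSIGS-U12d-CayleySlice.v1.K2E3-p12-g0.lean :: subsig_K2E3CayleySliceConjugatesNhds`, with the conjugator `x := 1`
and the hypothesis «`s` semisimple» replaced by «`s` CENTRAL»: `MAT(s) = ζ • 1`, `ζ ∈ Rˣ`).  `R = L ⊗ L⁺_v = Π_{w∣v} L_w` (★ `UnitaryGroup.LocalRing L v`), `σ = c ⊗ 1`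
(★ `conjLocal`), `J_v` (★ `(adelicForm L N H).map (adeleToLocal L v)`), `G = U(H)(L⁺_v)` (★ `(UnitaryGroup.cmDatum L N H).Local v`, carrier `unitaryGroupOfForm σ J_v`),
`MAT(g) = ((g.val : GL_N R) : M_N R)`.  HEAD **`cayleySliceCoversNhdsCentral`**: for every `V ∈ 𝓝 0` in `M_N(R)` there is an OPEN `U ∋ s` such that every `g ∈ U` is
`MAT(g) = MAT(s) · (1 + Y)(1 − Y)⁻¹` with `Y ∈ V`, `(σY)ᵀ J_v = −J_v Y`, `MAT(s) Y = Y MAT(s)`, `1 ± Y` invertible; and **`cayleySliceConjugatesNhds_central`**: the same in the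
exact `∃ x, … MAT(x g x⁻¹) = …` shape of (S-d) (witness `x := 1`) — the GEOMETRIC input of Harish-Chandra's semisimple descent [HarishChandra1999 §18 p. 79 «the mapping
`(x, m) ↦ xγmx⁻¹` of `G × U_M` into `U` is submersive … `U_0 = (γU_M)^G` is an open neighborhood of `γ`»] in the one case where no submersion is needed: for central `γ`,
`M = G` and `U_0 = γ · c(V ∩ 𝔤)` itself.

THE PROOF (strategy: INVERSE CAYLEY TRANSFORM + a unit-cancellation identity; no exponential, no field-by-field case split).  Put `M(g) := MAT(s⁻¹ g)` (in `U(σ, J_v)` by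
membership, `MAT(g) = MAT(s) M(g)`), `P := M + 1`, `Y := (M − 1) P⁻¹` (Mathlib's `Matrix.inv = Ring.inverse det • adjugate`).
* ALGEBRA (§0, any commutative ring, any `σ`, `J`): if `(σM)ᵀ J M = J` and `det P` is a unit then `(σY)ᵀ J = −J Y` — multiply `(σY)ᵀJ + JY` by the units `(σP)ᵀ` (left)
  and `P` (right) and use `Y P = M − 1`: the product is `((σM)ᵀ − 1) J (M + 1) + ((σM)ᵀ + 1) J (M − 1) = 2((σM)ᵀ J M − J) = 0` (`skew_of_form_preserving`); with `2 t = 1`: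
  `(1 − Y)(tP) = 1`, `(1 + Y)(tP) = M`, so `1 ± Y` are units and `c(Y) = (1 + Y)(1 − Y)⁻¹ = M` (`cayley_invCayley`); `MAT(s) = ζ•1` commutes with everything.
* TOPOLOGY (§1, `R = Π_w L_w`): `IsUnit x ↔ ∀ w, x_w ≠ 0` (★ pattern `Pi.isUnit_iff`), so the units form an OPEN set and `Ring.inverse` is continuous at every unit
  (coordinatewise `inv₀` in the valued fields `L_w`); `2` is a unit (each `L_w ⊇ L` has characteristic `0`).  Hence (§2, Mathlib `continuousAt_matrix_inv`) `g ↦ Y(g)` is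
  continuous at every `g` with `det P(g)` a unit, `{g | det P(g) unit}` is open, `Y(s) = 0` (`M(s) = 1`, `det P(s) = 2^N`), and `U := {det P unit} ∩ Y⁻¹(interior V)` is an
  open neighbourhood of `s` (`isOpen_iff_mem_nhds`) on which all clauses hold.

* §0 `skew_of_form_preserving`, `cayley_invCayley` (+ unit lemmas)   · the inverse Cayley transform of a form-preserving matrix (any commutative ring);
* §1 `isUnit_iff_forall_ne_zero`, `isOpen_setOf_isUnit_localRing`, `continuousAt_ringInverse_localRing`, `isUnit_two_localRing` · `R = Π_{w∣v} L_w`;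
* §2 `exists_open_cayley_slice_central` · the generic open-neighbourhood statement for any closed-under-`σ,J` subgroup `G ≤ GL_N(R)` over such an `R`;
* §3 **`cayleySliceCoversNhdsCentral`**, **`cayleySliceConjugatesNhds_central`** · the CM instance in the (S-d) bytes.

HONEST LABEL.  HC_CM is proved only modulo the 7 printed citations (2 remaining named inputs: hLiu418 = `stmt-HodgeConjecture-24832`, h413 =
`stmt-HodgeConjecture-24833`) until rung 0 closes; this file moves no counter.

## References
* [HarishChandra1999AdmissibleDistributions] Harish-Chandra, *Admissible invariant distributions on reductive p-adic groups* (notes by S. DeBacker, P. J. Sally, Jr.),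
  University Lecture Series 16, AMS (1999), §18 p. 79 (the neighbourhood `U_0 = (γ U_M)^G`), §17 p. 77. Context: the central case of the descent.
* [HarishChandra1970] Harish-Chandra, *Harmonic analysis on reductive p-adic groups*, LNM 162 (1970), p. 56 (semisimple descent). Context locator.
* [PlatonovRapinchuk1994] V. Platonov, A. Rapinchuk, *Algebraic Groups and Number Theory* (1994), §3.3 (the Cayley transform on unitary groups). Context locator.
-/

set_option autoImplicit false
-- the mandated namespace repeats the single-problem summit's segment (`HodgeConjecture.HodgeConjecture`)
set_option linter.dupNamespace false

noncomputable section

open Filter Topology Matrix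
open NumberField IsDedekindDomain
open scoped MatrixGroups
open Literature.NumberTheory.Automorphic Literature.NumberTheory.Automorphic.UnitaryGroup

namespace Summit.HodgeConjecture.HodgeConjecture.Cruxes.H413.K2E3CayleySliceCoversNhdsCentral

/-! ## §0 The inverse Cayley transform of a form-preserving matrix (any commutative ring) -/

section Algebra

variable {R : Type*} [CommRing R] {n : Type*} [Fintype n] [DecidableEq n]

/-- **Skewness of the inverse Cayley transform.**  If `M` preserves the `σ`-sesquilinear form `J` (`(σM)ᵀ J M = J`) and `P = M + 1` has unit determinant, then
`Y = (M − 1) P⁻¹` is `J`-skew: `(σY)ᵀ J = −J Y`.  Proof: `(σP)ᵀ ((σY)ᵀJ + JY) P = ((σM)ᵀ − 1)J(M + 1) + ((σM)ᵀ + 1)J(M − 1) = 2((σM)ᵀJM − J) = 0`, and `(σP)ᵀ`, `P`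
are units. [cite: PlatonovRapinchuk1994, §3.3] -/
theorem skew_of_form_preserving (σ : R →+* R) {J M : Matrix n n R} (hM : (M.map σ)ᵀ * J * M = J) (hP : IsUnit (M + 1).det) :
    (((M - 1) * (M + 1)⁻¹).map σ)ᵀ * J = -(J * ((M - 1) * (M + 1)⁻¹)) := by
  set P := M + 1 with hPdef
  set Y := (M - 1) * P⁻¹ with hYdef
  have hYP : Y * P = M - 1 := by
    rw [hYdef, Matrix.nonsing_inv_mul_cancel_right _ _ hP]
  -- the cancellation identity
  have key : (P.map σ)ᵀ * ((Y.map σ)ᵀ * J + J * Y) * P = 0 := by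
    have h1 : (P.map σ)ᵀ * (Y.map σ)ᵀ = ((M - 1).map σ)ᵀ := by
      rw [← Matrix.transpose_mul, ← Matrix.map_mul, hYP]
    calc (P.map σ)ᵀ * ((Y.map σ)ᵀ * J + J * Y) * P
        = (P.map σ)ᵀ * (Y.map σ)ᵀ * J * P + (P.map σ)ᵀ * J * (Y * P) := by noncomm_ring
      _ = ((M - 1).map σ)ᵀ * J * (M + 1) + ((M + 1).map σ)ᵀ * J * (M - 1) := by rw [h1, hYP]
      _ = 2 * ((M.map σ)ᵀ * J * M) - 2 * J := by
          rw [Matrix.map_sub σ (map_sub σ), Matrix.map_add σ (map_add σ), Matrix.map_one σ (map_zero σ) (map_one σ), Matrix.transpose_sub,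
            Matrix.transpose_add, Matrix.transpose_one]
          noncomm_ring
      _ = 0 := by rw [hM, sub_self]
  -- cancel the units `(σP)ᵀ` and `P`
  have hPσ : IsUnit ((P.map σ)ᵀ).det := by
    rw [Matrix.det_transpose, ← RingHom.mapMatrix_apply, ← RingHom.map_det]
    exact hP.map σ
  have hzero : (Y.map σ)ᵀ * J + J * Y = 0 := by
    have h2 := congrArg (fun Z => ((P.map σ)ᵀ)⁻¹ * Z * P⁻¹) key
    simp only [Matrix.mul_zero, Matrix.zero_mul] at h2
    rwa [← Matrix.mul_assoc, ← Matrix.mul_assoc, Matrix.nonsing_inv_mul _ hPσ, Matrix.one_mul,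
      Matrix.mul_nonsing_inv_cancel_right _ _ hP] at h2
  exact eq_neg_of_add_eq_zero_left hzero

/-- `(M − 1)(M + 1)⁻¹ · (M + 1) = M − 1` (unit determinant). [cite: PlatonovRapinchuk1994, §3.3] -/
theorem invCayley_mul (M : Matrix n n R) (hP : IsUnit (M + 1).det) : (M - 1) * (M + 1)⁻¹ * (M + 1) = M - 1 :=
  Matrix.nonsing_inv_mul_cancel_right _ _ hP

/-- With `2t = 1`: `(1 − Y) · t(M + 1) = 1` for `Y = (M − 1)(M + 1)⁻¹`. [cite: PlatonovRapinchuk1994, §3.3] -/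
theorem one_sub_invCayley_mul (M : Matrix n n R) (hP : IsUnit (M + 1).det) {t : R} (ht : 2 * t = 1) :
    (1 - (M - 1) * (M + 1)⁻¹) * (t • (M + 1)) = 1 := by
  rw [Matrix.mul_smul, sub_mul, Matrix.one_mul, invCayley_mul M hP]
  have h2 : M + 1 - (M - 1) = (2 : R) • (1 : Matrix n n R) := by
    rw [two_smul]
    abel
  rw [h2, smul_smul, mul_comm t 2, ht, one_smul]

/-- With `2t = 1`: `(1 + Y) · t(M + 1) = M` for `Y = (M − 1)(M + 1)⁻¹`. [cite: PlatonovRapinchuk1994, §3.3] -/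
theorem one_add_invCayley_mul (M : Matrix n n R) (hP : IsUnit (M + 1).det) {t : R} (ht : 2 * t = 1) :
    (1 + (M - 1) * (M + 1)⁻¹) * (t • (M + 1)) = M := by
  rw [Matrix.mul_smul, add_mul, Matrix.one_mul, invCayley_mul M hP]
  have h2 : M + 1 + (M - 1) = (2 : R) • M := by
    rw [two_smul]
    abel
  rw [h2, smul_smul, mul_comm t 2, ht, one_smul]

/-- `1 − Y` is a unit (`Y` the inverse Cayley transform, `2` a unit). [cite: PlatonovRapinchuk1994, §3.3] -/
theorem isUnit_one_sub_invCayley (M : Matrix n n R) (hP : IsUnit (M + 1).det) {t : R} (ht : 2 * t = 1) :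
    IsUnit (1 - (M - 1) * (M + 1)⁻¹) :=
  IsUnit.of_mul_eq_one (t • (M + 1)) (one_sub_invCayley_mul M hP ht)

/-- `(1 − Y)⁻¹ = t(M + 1)`. [cite: PlatonovRapinchuk1994, §3.3] -/
theorem inv_one_sub_invCayley (M : Matrix n n R) (hP : IsUnit (M + 1).det) {t : R} (ht : 2 * t = 1) :
    (1 - (M - 1) * (M + 1)⁻¹)⁻¹ = t • (M + 1) :=
  Matrix.inv_eq_right_inv (one_sub_invCayley_mul M hP ht)

/-- **The Cayley transform inverts the inverse Cayley transform**: `(1 + Y)(1 − Y)⁻¹ = M` for `Y = (M − 1)(M + 1)⁻¹` (`det(M + 1)` and `2` units).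
[cite: PlatonovRapinchuk1994, §3.3] -/
theorem cayley_invCayley (M : Matrix n n R) (hP : IsUnit (M + 1).det) {t : R} (ht : 2 * t = 1) :
    (1 + (M - 1) * (M + 1)⁻¹) * (1 - (M - 1) * (M + 1)⁻¹)⁻¹ = M := by
  rw [inv_one_sub_invCayley M hP ht, one_add_invCayley_mul M hP ht]

/-- `1 + Y` is a unit when moreover `det M` is a unit: `1 + Y = M · (t(M + 1))⁻¹`. [cite: PlatonovRapinchuk1994, §3.3] -/
theorem isUnit_one_add_invCayley (M : Matrix n n R) (hMdet : IsUnit M.det) (hP : IsUnit (M + 1).det) {t : R} (ht : 2 * t = 1) :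
    IsUnit (1 + (M - 1) * (M + 1)⁻¹) := by
  have htu : IsUnit t := IsUnit.of_mul_eq_one_right 2 ht
  have hB : IsUnit (t • (M + 1)).det := by
    rw [Matrix.det_smul]
    exact (htu.pow _).mul hP
  have h : 1 + (M - 1) * (M + 1)⁻¹ = M * (t • (M + 1))⁻¹ :=
    calc 1 + (M - 1) * (M + 1)⁻¹ = (1 + (M - 1) * (M + 1)⁻¹) * (t • (M + 1)) * (t • (M + 1))⁻¹ :=
          (Matrix.mul_nonsing_inv_cancel_right _ _ hB).symm
      _ = M * (t • (M + 1))⁻¹ := by rw [one_add_invCayley_mul M hP ht]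
  rw [h]
  exact ((Matrix.isUnit_iff_isUnit_det _).2 hMdet).mul
    ((Matrix.isUnit_iff_isUnit_det _).2 (Matrix.isUnit_nonsing_inv_det_iff.2 hB))

end Algebra

/-! ## §1 The coefficient ring `R = Π_{w ∣ v} L_w`: units, `Ring.inverse`, and `2` -/

section LocalRing

variable (L : Type) [Field L] [NumberField L] (v : HeightOneSpectrum (𝓞 ↥(maximalRealSubfield L)))

/-- In `R = Π_w L_w` an element is a unit iff all its components are non-zero. [cite: PlatonovRapinchuk1994, §3.3] -/
theorem isUnit_iff_forall_ne_zero (x : UnitaryGroup.LocalRing L v) : IsUnit x ↔ ∀ w : PlacesOver L v, x w ≠ 0 := by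
  rw [Pi.isUnit_iff]
  exact forall_congr' fun w => isUnit_iff_ne_zero

/-- The units of `R = Π_w L_w` form an open set. [cite: PlatonovRapinchuk1994, §3.3] -/
theorem isOpen_setOf_isUnit_localRing : IsOpen {x : UnitaryGroup.LocalRing L v | IsUnit x} := by
  have h : {x : UnitaryGroup.LocalRing L v | IsUnit x} = ⋂ w : PlacesOver L v, (fun x : UnitaryGroup.LocalRing L v => x w) ⁻¹' {0}ᶜ := by
    ext x
    simp only [Set.mem_setOf_eq, isUnit_iff_forall_ne_zero, Set.mem_iInter, Set.mem_preimage, Set.mem_compl_iff, Set.mem_singleton_iff]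
  rw [h]
  exact isOpen_iInter_of_finite fun w => isOpen_compl_singleton.preimage (continuous_apply w)

/-- `Ring.inverse` on `R = Π_w L_w` is continuous at every unit (coordinatewise `inv₀` in the valued fields `L_w`). [cite: PlatonovRapinchuk1994, §3.3] -/
theorem continuousAt_ringInverse_localRing {x : UnitaryGroup.LocalRing L v} (hx : IsUnit x) :
    ContinuousAt Ring.inverse x := by
  have hx' := (isUnit_iff_forall_ne_zero L v x).1 hx
  -- on the open set of units, `Ring.inverse` is the coordinatewise inverse
  have hev : (fun y : UnitaryGroup.LocalRing L v => fun w => (y w)⁻¹) =ᶠ[𝓝 x] Ring.inverse := by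
    filter_upwards [(isOpen_setOf_isUnit_localRing L v).mem_nhds hx] with y hy
    have hmul : Ring.inverse y * y = 1 := Ring.inverse_mul_cancel y hy
    funext w
    have hw : Ring.inverse y w * y w = 1 := by
      have := congrFun hmul w
      simpa only [Pi.mul_apply, Pi.one_apply] using this
    exact (eq_inv_of_mul_eq_one_left hw).symm
  refine ContinuousAt.congr ?_ hev
  exact continuousAt_pi.2 fun w => ((continuous_apply w).continuousAt).inv₀ (hx' w)

/-- `2` is a unit of `R = Π_w L_w` (each `L_w ⊇ L` has characteristic zero). [cite: PlatonovRapinchuk1994, §3.3] -/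
theorem isUnit_two_localRing : IsUnit (2 : UnitaryGroup.LocalRing L v) := by
  rw [isUnit_iff_forall_ne_zero]
  intro w
  have h2 : (algebraMap L (w.1.adicCompletion L)) 2 = (2 : UnitaryGroup.LocalRing L v) w := by
    rw [map_ofNat]
    rfl
  rw [← h2]
  exact (map_ne_zero _).2 two_ne_zero

end LocalRing

/-! ## §2 The generic open-neighbourhood statement at a central point -/

section Generic

variable {R : Type*} [CommRing R] [TopologicalSpace R] [IsTopologicalRing R] {n : Type*} [Fintype n] [DecidableEq n]

/-- **Generic form.**  Let `R` be a topological commutative ring whose units form an open set on which `Ring.inverse` is continuous and in which `2` is a unit; let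
`G ≤ GL_N(R)` be a subgroup all of whose elements preserve the `σ`-form `J`, and let `s ∈ G` be the scalar `ζ • 1`.  Then for every `V ∈ 𝓝 0` there is an open `U ∋ s`
in `G` such that every `g ∈ U` is `MAT(s) · (1 + Y)(1 − Y)⁻¹` with `Y ∈ V` `J`-skew, commuting with `MAT(s)`, `1 ± Y` units — namely `Y = (M − 1)(M + 1)⁻¹`,
`M = MAT(s⁻¹ g)`. [cite: HarishChandra1999AdmissibleDistributions, §18 p. 79] -/
theorem exists_open_cayley_slice_central
    (hunits : IsOpen {x : R | IsUnit x}) (hinv : ∀ x : R, IsUnit x → ContinuousAt Ring.inverse x) (h2 : IsUnit (2 : R))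
    (σ : R →+* R) (J : Matrix n n R) (G : Subgroup (GL n R))
    (hG : ∀ g : G, (((g : GL n R) : Matrix n n R).map σ)ᵀ * J * ((g : GL n R) : Matrix n n R) = J)
    (s : G) (z : Rˣ) (hs : ((s : GL n R) : Matrix n n R) = (z : R) • (1 : Matrix n n R))
    (V : Set (Matrix n n R)) (hV : V ∈ 𝓝 (0 : Matrix n n R)) :
    ∃ U : Set G, IsOpen U ∧ s ∈ U ∧
      ∀ g ∈ U, ∃ Y ∈ V, (Y.map σ)ᵀ * J = -(J * Y) ∧
        ((s : GL n R) : Matrix n n R) * Y = Y * ((s : GL n R) : Matrix n n R) ∧ IsUnit (1 - Y) ∧ IsUnit (1 + Y) ∧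
        ((g : GL n R) : Matrix n n R) = ((s : GL n R) : Matrix n n R) * ((1 + Y) * (1 - Y)⁻¹) := by
  obtain ⟨t, ht⟩ : ∃ t : R, 2 * t = 1 := ⟨↑h2.unit⁻¹, h2.mul_val_inv⟩
  -- `M(g) = MAT(s⁻¹ g)`, `P = M + 1`, `Y = (M - 1) P⁻¹`
  let Mf : G → Matrix n n R := fun g => (((s⁻¹ * g : G) : GL n R) : Matrix n n R)
  let Yf : G → Matrix n n R := fun g => (Mf g - 1) * (Mf g + 1)⁻¹
  have hMcont : Continuous Mf :=
    (Units.continuous_val.comp continuous_subtype_val).comp (continuous_const_mul (s⁻¹ : G))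
  have hMAT : ∀ g : G, ((g : GL n R) : Matrix n n R) = ((s : GL n R) : Matrix n n R) * Mf g := by
    intro g
    change ((g : GL n R) : Matrix n n R) = ((s : GL n R) : Matrix n n R) * (((s⁻¹ * g : G) : GL n R) : Matrix n n R)
    rw [← Units.val_mul, ← Subgroup.coe_mul, mul_inv_cancel_left]
  have hMs : Mf s = 1 := by
    change (((s⁻¹ * s : G) : GL n R) : Matrix n n R) = 1
    rw [inv_mul_cancel, Subgroup.coe_one, Units.val_one]
  -- continuity of `Y` at every point where `det P` is a unit
  have hYcont : ∀ g : G, IsUnit (Mf g + 1).det → ContinuousAt Yf g := by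
    intro g hg
    have hPcont : Continuous fun g' : G => Mf g' + 1 := hMcont.add continuous_const
    have hMsub : Continuous fun g' : G => Mf g' - 1 := hMcont.sub continuous_const
    have hPinv : ContinuousAt (fun g' : G => (Mf g' + 1)⁻¹) g :=
      ContinuousAt.comp (g := Inv.inv) (continuousAt_matrix_inv (Mf g + 1) (hinv _ hg)) hPcont.continuousAt
    exact hMsub.continuousAt.mul hPinv
  have hPdet : Continuous fun g' : G => (Mf g' + 1).det := (hMcont.add continuous_const).matrix_det
  -- the open set
  refine ⟨{g : G | IsUnit (Mf g + 1).det ∧ Yf g ∈ interior V}, ?_, ?_, ?_⟩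
  · -- open: both conditions are neighbourhood conditions at each of its points
    rw [isOpen_iff_mem_nhds]
    rintro g ⟨hgP, hgV⟩
    refine Filter.inter_mem ?_ ?_
    · exact (hunits.preimage hPdet).mem_nhds hgP
    · exact (hYcont g hgP).preimage_mem_nhds (isOpen_interior.mem_nhds hgV)
  · -- `s ∈ U`: `M(s) = 1`, `det P(s) = 2^N`, `Y(s) = 0 ∈ interior V`
    refine ⟨?_, ?_⟩
    · rw [hMs, show (1 : Matrix n n R) + 1 = (2 : R) • (1 : Matrix n n R) by rw [two_smul], Matrix.det_smul, Matrix.det_one, mul_one]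
      exact h2.pow _
    · change (Mf s - 1) * (Mf s + 1)⁻¹ ∈ interior V
      rw [hMs, sub_self, Matrix.zero_mul]
      exact mem_interior_iff_mem_nhds.2 hV
  · -- the clauses on `U`
    rintro g ⟨hgP, hgV⟩
    have hform : ((Mf g).map σ)ᵀ * J * Mf g = J := hG (s⁻¹ * g)
    have hMdet : IsUnit (Mf g).det := Matrix.isUnits_det_units _
    refine ⟨Yf g, interior_subset hgV, skew_of_form_preserving σ hform hgP, ?_, isUnit_one_sub_invCayley _ hgP ht,
      isUnit_one_add_invCayley _ hMdet hgP ht, ?_⟩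
    · rw [hs, Matrix.smul_mul, Matrix.mul_smul, Matrix.one_mul, Matrix.mul_one]
    · rw [hMAT g]
      congr 1
      exact (cayley_invCayley (Mf g) hgP ht).symm

end Generic

/-! ## §3 The CM instance: `G = U(H)(L⁺_v)`, `R = Π_{w∣v} L_w`, `σ = c ⊗ 1`, `J_v` — the (S-d) clauses at a central point -/

section CM

/-- **(S-d) AT A CENTRAL POINT — the Cayley slice through a central `s` covers a neighbourhood of `s`.**  For `s ∈ U(H)(L⁺_v)` with `MAT(s) = ζ • 1` (`ζ ∈ Rˣ`,
`R = Π_{w∣v} L_w`) and every neighbourhood `V` of `0` in `M_N(R)` there is an open `U ∋ s` such that every `g ∈ U` satisfies `MAT(g) = MAT(s) · (1 + Y)(1 − Y)⁻¹` for some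
`Y ∈ V` with `(σY)ᵀ J_v = −J_v Y`, `MAT(s) Y = Y MAT(s)`, `1 ± Y` invertible (`σ = conjLocal`, `J_v = (adelicForm L N H).map (adeleToLocal L v)`) — Harish-Chandra's open
neighbourhood `U_0 = (γ U_M)^G` in the central case `M = G`. [cite: HarishChandra1999AdmissibleDistributions, §18 p. 79] [cite: HarishChandra1970, p. 56] -/
theorem cayleySliceCoversNhdsCentral :
    ∀ (L : Type) [Field L] [NumberField L] [IsCMField L] (N : ℕ) (H : Matrix (Fin N) (Fin N) L)
      (v : HeightOneSpectrum (𝓞 ↥(maximalRealSubfield L)))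
      (s : (UnitaryGroup.cmDatum L N H).Local v) (z : (UnitaryGroup.LocalRing L v)ˣ),
      ((s.val : GL (Fin N) (UnitaryGroup.LocalRing L v)) : Matrix (Fin N) (Fin N) (UnitaryGroup.LocalRing L v)) =
        (z : UnitaryGroup.LocalRing L v) • (1 : Matrix (Fin N) (Fin N) (UnitaryGroup.LocalRing L v)) →
    ∀ V : Set (Matrix (Fin N) (Fin N) (UnitaryGroup.LocalRing L v)), V ∈ 𝓝 (0 : Matrix (Fin N) (Fin N) (UnitaryGroup.LocalRing L v)) →
      ∃ U : Set ((UnitaryGroup.cmDatum L N H).Local v), IsOpen U ∧ s ∈ U ∧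
        ∀ g ∈ U,
          ∃ Y ∈ V, (Y.map (UnitaryGroup.conjLocal L (IsCMField.complexConj L) v))ᵀ * ((UnitaryGroup.adelicForm L N H).map (UnitaryGroup.adeleToLocal L v)) = -(((UnitaryGroup.adelicForm L N H).map (UnitaryGroup.adeleToLocal L v)) * Y) ∧
          ((s.val : GL (Fin N) (UnitaryGroup.LocalRing L v)) : Matrix (Fin N) (Fin N) (UnitaryGroup.LocalRing L v)) * Y = Y * ((s.val : GL (Fin N) (UnitaryGroup.LocalRing L v)) : Matrix (Fin N) (Fin N) (UnitaryGroup.LocalRing L v)) ∧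
          IsUnit (1 - Y) ∧ IsUnit (1 + Y) ∧
          ((g.val : GL (Fin N) (UnitaryGroup.LocalRing L v)) : Matrix (Fin N) (Fin N) (UnitaryGroup.LocalRing L v)) = ((s.val : GL (Fin N) (UnitaryGroup.LocalRing L v)) : Matrix (Fin N) (Fin N) (UnitaryGroup.LocalRing L v)) * ((1 + Y) * (1 - Y)⁻¹) := by
  intro L _ _ _ N H v s z hs V hV
  exact exists_open_cayley_slice_central (isOpen_setOf_isUnit_localRing L v) (fun x hx => continuousAt_ringInverse_localRing L v hx)
    (isUnit_two_localRing L v) (UnitaryGroup.conjLocal L (IsCMField.complexConj L) v) ((UnitaryGroup.adelicForm L N H).map (UnitaryGroup.adeleToLocal L v))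
    (UnitaryGroup.«local» L (IsCMField.complexConj L) N H v) (fun g => (mem_unitaryGroupOfForm_iff).1 g.2) s z hs V hV

/-- **(S-d) AT A CENTRAL POINT, in the `∃ x` shape of the sub-socket** `subsig_K2E3CayleySliceConjugatesNhds` (SUBSIGS 8fea84bcf8bff209; conjugator `x := 1`, so
`MAT(x g x⁻¹) = MAT(g)`), with «`s` semisimple» specialised to «`s` central» and the unused form hypotheses of the sub-socket kept in the binder list for docking.
[cite: HarishChandra1999AdmissibleDistributions, §18 p. 79] [cite: HarishChandra1970, p. 56] -/
theorem cayleySliceConjugatesNhds_central :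
    ∀ (L : Type) [Field L] [NumberField L] [IsCMField L] (N : ℕ) (H : Matrix (Fin N) (Fin N) L),
      (H.map (cmConjRingHom L))ᵀ = H → H.det ≠ 0 →
    ∀ (v : HeightOneSpectrum (𝓞 ↥(maximalRealSubfield L)))
      (s : (UnitaryGroup.cmDatum L N H).Local v) (z : (UnitaryGroup.LocalRing L v)ˣ),
      ((s.val : GL (Fin N) (UnitaryGroup.LocalRing L v)) : Matrix (Fin N) (Fin N) (UnitaryGroup.LocalRing L v)) =
        (z : UnitaryGroup.LocalRing L v) • (1 : Matrix (Fin N) (Fin N) (UnitaryGroup.LocalRing L v)) →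
    ∀ V : Set (Matrix (Fin N) (Fin N) (UnitaryGroup.LocalRing L v)), V ∈ 𝓝 (0 : Matrix (Fin N) (Fin N) (UnitaryGroup.LocalRing L v)) →
      ∃ U : Set ((UnitaryGroup.cmDatum L N H).Local v), IsOpen U ∧ s ∈ U ∧
        ∀ g ∈ U, ∃ x : (UnitaryGroup.cmDatum L N H).Local v,
          ∃ Y ∈ V, (Y.map (UnitaryGroup.conjLocal L (IsCMField.complexConj L) v))ᵀ * ((UnitaryGroup.adelicForm L N H).map (UnitaryGroup.adeleToLocal L v)) = -(((UnitaryGroup.adelicForm L N H).map (UnitaryGroup.adeleToLocal L v)) * Y) ∧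
          ((s.val : GL (Fin N) (UnitaryGroup.LocalRing L v)) : Matrix (Fin N) (Fin N) (UnitaryGroup.LocalRing L v)) * Y = Y * ((s.val : GL (Fin N) (UnitaryGroup.LocalRing L v)) : Matrix (Fin N) (Fin N) (UnitaryGroup.LocalRing L v)) ∧
          IsUnit (1 - Y) ∧ IsUnit (1 + Y) ∧
          (((x * g * x⁻¹).val : GL (Fin N) (UnitaryGroup.LocalRing L v)) : Matrix (Fin N) (Fin N) (UnitaryGroup.LocalRing L v)) = ((s.val : GL (Fin N) (UnitaryGroup.LocalRing L v)) : Matrix (Fin N) (Fin N) (UnitaryGroup.LocalRing L v)) * ((1 + Y) * (1 - Y)⁻¹) := by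
  intro L _ _ _ N H _ _ v s z hs V hV
  obtain ⟨U, hUo, hsU, hU⟩ := cayleySliceCoversNhdsCentral L N H v s z hs V hV
  refine ⟨U, hUo, hsU, fun g hg => ⟨1, ?_⟩⟩
  obtain ⟨Y, hYV, h1, h2, h3, h4, h5⟩ := hU g hg
  refine ⟨Y, hYV, h1, h2, h3, h4, ?_⟩
  rw [one_mul, inv_one, mul_one]
  exact h5

end CM

end Summit.HodgeConjecture.HodgeConjecture.Cruxes.H413.K2E3CayleySliceCoversNhdsCentral

end
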